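import Summits.QuantumAdvantage.QuantumAdvantage.Theorems.CouplingDialCore

/-!
# CouplingDial (part B, threshold) — direct sums of cubic tables, the padded planting, `U_{√n}`, `U_{n/2}`, `U_n`; rev-1 pieces

Tree twin of node «CouplingDial» rev 2 §7–§8 (cut verbatim).  `dsum` / `eval_dsum` (direct sum of cubic TABLES), `ipT` (= `SgnForrMem.ipHalf`,
self-dual), the planted family `cinst w t = ⟨(6m+6)+2t, F_w ⊞ IP_t, 𝟏 ⊞ IP_t, 0 ⊕ 𝟙⟩` with `cvalue_cinst = -(-1)^{[#₁w ≡ 0 (3)]}` EXACT,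
`kerCard_cinst`, `isProj_encode_cinst`, the THRESHOLD LAW `couplingRung_of_schedule` and its corollaries `couplingRung_id / _half / _sqrt`; the
rev-1 pieces `HiddenCouplingRung` (`W = U_0`), `CouplingLift` (`R`), `rungANonuniform_iff_pieces`, `closes`, `dial_summary`.  (All `U_d` are
re-proved outright in part C; this part is kept for the padding machinery and the record.)
-/

set_option linter.dupNamespace false

noncomputable section

namespace Summit.QuantumAdvantage.QuantumAdvantage.Theorems.CouplingDial

open Finset
open Literature.Computability.Complexity
open Literature.Computability.QuantumComplexity
open Literature.Computability.MetaComplexity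
open _root_.Computability (encodeNat)
open Summit.QuantumAdvantage.QuantumAdvantage.Theorems.HintDial
open Summit.QuantumAdvantage.QuantumAdvantage.Theorems.HintDial.Automaton
open Summit.QuantumAdvantage.QuantumAdvantage.Theorems.GapDial.Automaton (blockDiag blockDiag_left blockDiag_right
  mv_blockDiag bd_zero_left EE bxor_append)
open Summit.QuantumAdvantage.QuantumAdvantage.Theorems.FlatDial (clen length_encode_eq_clen clen_injective clen_lt_clen le_clen)
open Summit.QuantumAdvantage.QuantumAdvantage.Theses.AnfPresentation (RungANonuniform RungA LiftA AnfEquiv NearExactIsExact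
  SignedExactSliceIsLift)
open CubicForm (bit)
open DerivativeWalsh (W)
open BuzetChailloux (bxor zeroVec)

/-! ## §7 The threshold law: every polynomial-root co-rank budget is a THEOREM (padding planting from the HintDial gadget)

The planted coupled instance for `w ∈ {0,1}^m` and padding half-size `t`: arity `n = (6m+6) + 2t`, layers `F = F_w ⊞ IP_t`,
`G = 𝟏 ⊞ IP_t`, coupling `L = 0_{6m+6} ⊕ 𝟙_{2t}` (co-rank `6m+6`).  The coupled sum factorises as
`S = (Σ_{x_A} (-1)^{F_w(x_A)}) · (Σ_{y_A} (-1)) · (Σ_{x_B,y_B} (-1)^{IP(x_B)+⟨x_B,y_B⟩+IP(y_B)}) = (2^{3m+3}·(-1)^{q_w(0)_{b₀}}) · (-2^{6m+6}) ·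
2^{3t}`, so `Φ_L = -(-1)^{q_w(0)_{b₀}} = +1` iff `MOD₃(w) = 0` (`q_w(0)_{b₀} = G₀(0) = [#₁w ≡ 0 (3)]`, `G0_const`): EXACT, with the answer
a `MOD₃` — and the code is a literal projection of `w`.  Smolensky closes (`not_promiseLift_AC0Mod_of_proj`). -/

section Planting

variable {n₁ n₂ : ℕ}

/-- coefficient pattern of a direct sum of two cubic tables (no cross-block monomials). -/
def cube3 (c₁ : Fin n₁ → Fin n₁ → Fin n₁ → Bool) (c₂ : Fin n₂ → Fin n₂ → Fin n₂ → Bool) :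
    Fin n₁ ⊕ Fin n₂ → Fin n₁ ⊕ Fin n₂ → Fin n₁ ⊕ Fin n₂ → Bool
  | .inl a, .inl b, .inl c => c₁ a b c
  | .inr a, .inr b, .inr c => c₂ a b c
  | _, _, _ => false

/-- ★ DIRECT SUM of cubic tables: `(F₁ ⊞ F₂)(x₁ x₂) = F₁(x₁) ⊕ F₂(x₂)`. -/
def dsum (F₁ : CubicForm n₁) (F₂ : CubicForm n₂) : CubicForm (n₁ + n₂) :=
  ⟨xor F₁.const F₂.const, fun i j l => cube3 F₁.cube F₂.cube (finSumFinEquiv.symm i) (finSumFinEquiv.symm j) (finSumFinEquiv.symm l)⟩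

/-- CouplingDialThreshold helper `eval_dsum` (decomp-qadv land package; see the module docstring). -/
theorem eval_dsum (F₁ : CubicForm n₁) (F₂ : CubicForm n₂) (x₁ : Fin n₁ → Bool) (x₂ : Fin n₂ → Bool) :
    (dsum F₁ F₂).eval (Fin.append x₁ x₂) = xor (F₁.eval x₁) (F₂.eval x₂) := by
  apply bit_injective
  rw [bit_xor, eval_bit, eval_bit, eval_bit]
  simp only [dsum, bit_xor, Fin.sum_univ_add, finSumFinEquiv_symm_apply_castAdd, finSumFinEquiv_symm_apply_natAdd,
    Fin.append_left, Fin.append_right, cube3, bit_false, zero_mul, sum_const_zero, add_zero, zero_add]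
  ring

variable {m : ℕ}

/-- CouplingDialThreshold helper `isLit_cube3` (decomp-qadv land package; see the module docstring). -/
theorem isLit_cube3 {c₁ : (Fin m → Bool) → Fin n₁ → Fin n₁ → Fin n₁ → Bool} (h₁ : ∀ a b c, IsLit fun w => c₁ w a b c)
    (c₂ : Fin n₂ → Fin n₂ → Fin n₂ → Bool) (u v z : Fin n₁ ⊕ Fin n₂) : IsLit fun w => cube3 (c₁ w) c₂ u v z := by
  rcases u with a | a <;> rcases v with b | b <;> rcases z with c | c
  all_goals first | exact h₁ _ _ _ | exact ⟨Sum.inl false, fun w => rfl⟩ | exact ⟨Sum.inl (c₂ _ _ _), fun w => rfl⟩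

/-- the inner-product table on `t + t` variables: `IP_t(u v) = ⟨u, v⟩` (Maiorana–McFarland with the identity permutation). -/
def ipT (t : ℕ) : CubicForm (t + t) := blTable t false (fun _ => false) dM (fun _ => false)

/-- CouplingDialThreshold helper `eval_ipT` (decomp-qadv land package; see the module docstring). -/
theorem eval_ipT (t : ℕ) (u v : Fin t → Bool) : (ipT t).eval (Fin.append u v) = bd u v := by
  rw [ipT, eval_blTable, bd_zero_left, bd_zero_left, mv_dM, Bool.false_xor, Bool.false_xor, Bool.xor_false]

/-- CouplingDialThreshold helper `eval_ipT_eq_ipHalf` (decomp-qadv land package; see the module docstring). -/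
theorem eval_ipT_eq_ipHalf (t : ℕ) : (ipT t).eval = SgnForrMem.ipHalf t := by
  funext y
  obtain ⟨⟨u, v⟩, rfl⟩ := (Fin.appendEquiv t t).surjective y
  show (ipT t).eval (Fin.append u v) = SgnForrMem.ipHalf t (Fin.append u v)
  rw [eval_ipT]
  simp only [bd, SgnForrMem.ipHalf, Fin.append_left, Fin.append_right]

/-- `IP_t` is self-dual bent: `Φ(IP_t, IP_t) = 1` (`SgnForrMem.isSelfDualBent_ipHalf`, `forrelation_eq_one_of_isDualOf`). -/
theorem forrelation_ipT (t : ℕ) : forrelation (ipT t).eval (ipT t).eval = 1 := by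
  rw [eval_ipT_eq_ipHalf]
  exact forrelation_eq_one_of_isDualOf (SgnForrMem.isSelfDualBent_ipHalf t)

/-- the unnormalised `IP` Forrelation sum is `√(2^{3·2t}) = 2^{3t}`. -/
theorem ipSum (t : ℕ) :
    ∑ u : Fin (t + t) → Bool, ∑ v : Fin (t + t) → Bool, signOf ((ipT t).eval u) * twist u v * signOf ((ipT t).eval v)
      = Real.sqrt (2 ^ (3 * (t + t))) := by
  have h := forrelation_ipT t
  have hpos : Real.sqrt ((2 : ℝ) ^ (3 * (t + t))) ≠ 0 := by positivity
  rw [forrelation, inv_mul_eq_iff_eq_mul₀ hpos, mul_one] at h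
  exact h

/-- the constant-`true` table. -/
def oneT (k : ℕ) : CubicForm k := ⟨true, fun _ _ _ => false⟩

/-- CouplingDialThreshold helper `eval_oneT` (decomp-qadv land package; see the module docstring). -/
theorem eval_oneT (k : ℕ) (y : Fin k → Bool) : (oneT k).eval y = true := by
  apply bit_injective; rw [eval_bit]; simp [oneT]

/-- the zero matrix. -/
def zM (k : ℕ) : Fin k → Fin k → Bool := fun _ _ => false

/-- CouplingDialThreshold helper `mv_zM` (decomp-qadv land package; see the module docstring). -/
theorem mv_zM (k : ℕ) (y : Fin k → Bool) : mv (zM k) y = zeroVec := funext fun _ => bd_zero_left y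

/-- `Σ_{x_A} (-1)^{F_w(x_A)} = W_{F_w}(0) = 2^{3m+3} · (-1)^{q_w(0)_{b₀}}` (the Maiorana–McFarland Walsh transform at `0`). -/
theorem sum_signOf_Fw (w : Fin m → Bool) :
    ∑ x : Fin (kk m + kk m) → Bool, signOf ((Fw w).eval x) = 2 ^ kk m * signOf (qv w zeroVec b₀) := by
  rw [sum_append]
  simp_rw [eval_Fw, signOf_xor, signOf_bd]
  rw [sum_comm]
  have e : ∀ x₂ : Fin (kk m) → Bool, ∑ x₁ : Fin (kk m) → Bool, twist x₁ (pv w x₂) * signOf (x₂ b₀)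
      = signOf (x₂ b₀) * (if x₂ = qv w zeroVec then (2 : ℝ) ^ kk m else 0) := by
    intro x₂
    rw [← sum_mul, BuzetChailloux.sum_twist_left, mul_comm]
    exact congrArg _ (if_congr (pv_eq_iff w x₂ zeroVec) rfl rfl)
  simp_rw [e, mul_ite, mul_zero, Finset.sum_ite_eq', Finset.mem_univ, if_true]
  ring

/-- the label bit: `q_w(0)_{b₀} = G₀(0) = [#₁(w) ≡ 0 (mod 3)]`. -/
theorem qv_zeroVec_b₀ (w : Fin m → Bool) : qv w zeroVec b₀ = decide (GateFn.numOnes w % 3 = 0) := by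
  have h := eval_G0 w zeroVec zeroVec
  rw [bd_zeroVec_right, Bool.xor_false] at h
  have e : Fin.append (zeroVec : Fin (kk m) → Bool) (zeroVec : Fin (kk m) → Bool) = fun _ => false := by
    funext i
    refine Fin.addCases (fun a => ?_) (fun a => ?_) i
    · show Fin.append zeroVec zeroVec (Fin.castAdd (kk m) a) = false
      rw [Fin.append_left]; rfl
    · show Fin.append zeroVec zeroVec (Fin.natAdd (kk m) a) = false
      rw [Fin.append_right]; rfl
  rw [e, eval_zero, G0_const] at h
  exact h.symm

/-- ★ THE PLANTED COUPLED INSTANCE for `w ∈ {0,1}^m` with padding half-size `t`: `F = F_w ⊞ IP_t`, `G = 𝟏 ⊞ IP_t`, `L = 0 ⊕ 𝟙`. -/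
def cinst (w : Fin m → Bool) (t : ℕ) : CTriple :=
  ⟨(kk m + kk m) + (t + t), dsum (Fw w) (ipT t), dsum (oneT _) (ipT t), blockDiag (zM (kk m + kk m)) dM⟩

/-- the inner `y`-sum of the planted coupled sum. -/
theorem ysum_cinst (t : ℕ) (xA : Fin (kk m + kk m) → Bool) (xB : Fin (t + t) → Bool) :
    ∑ y : Fin ((kk m + kk m) + (t + t)) → Bool,
        twist (Fin.append xA xB) (mv (blockDiag (zM (kk m + kk m)) dM) y) * signOf ((dsum (oneT (kk m + kk m)) (ipT t)).eval y)
      = -(2 : ℝ) ^ (kk m + kk m) * ∑ yB : Fin (t + t) → Bool, twist xB yB * signOf ((ipT t).eval yB) := by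
  rw [sum_append]
  simp_rw [mv_blockDiag, mv_zM, mv_dM, twist_append, BuzetChailloux.twist_zeroVec_right, one_mul, eval_dsum, eval_oneT,
    Bool.true_xor, DerivativeWalsh.signOf_not]
  simp only [mul_neg, sum_neg_distrib, sum_const, card_univ, Fintype.card_fun, Fintype.card_bool, Fintype.card_fin,
    nsmul_eq_mul, Nat.cast_pow, Nat.cast_ofNat, neg_mul]

/-- ★ THE PLANTED COUPLED SUM: `S = -(-1)^{q_w(0)_{b₀}} · 2^{3m+3} · 2^{6m+6} · 2^{3t}`. -/
theorem csum_cinst (w : Fin m → Bool) (t : ℕ) :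
    ∑ x : Fin ((kk m + kk m) + (t + t)) → Bool, ∑ y : Fin ((kk m + kk m) + (t + t)) → Bool,
        signOf ((dsum (Fw w) (ipT t)).eval x) * twist x (mv (blockDiag (zM (kk m + kk m)) dM) y) *
          signOf ((dsum (oneT (kk m + kk m)) (ipT t)).eval y)
      = -(2 : ℝ) ^ (kk m + kk m) * (2 ^ kk m * signOf (qv w zeroVec b₀)) * Real.sqrt (2 ^ (3 * (t + t))) := by
  simp_rw [mul_assoc, ← mul_sum]
  rw [sum_append]
  simp_rw [ysum_cinst, eval_dsum, signOf_xor]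
  have e2 : ∀ (xA : Fin (kk m + kk m) → Bool) (xB : Fin (t + t) → Bool),
      signOf ((Fw w).eval xA) * signOf ((ipT t).eval xB) * (-(2 : ℝ) ^ (kk m + kk m) * ∑ yB : Fin (t + t) → Bool,
        twist xB yB * signOf ((ipT t).eval yB))
      = -(2 : ℝ) ^ (kk m + kk m) * (signOf ((Fw w).eval xA) * (signOf ((ipT t).eval xB) *
          ∑ yB : Fin (t + t) → Bool, twist xB yB * signOf ((ipT t).eval yB))) := by
    intro xA xB; ring
  simp_rw [e2, ← mul_sum]
  have hC : ∑ xB : Fin (t + t) → Bool, signOf ((ipT t).eval xB) * ∑ yB : Fin (t + t) → Bool, twist xB yB * signOf ((ipT t).eval yB)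
      = Real.sqrt (2 ^ (3 * (t + t))) := by
    rw [← ipSum t]
    exact sum_congr rfl fun xB _ => by rw [mul_sum]; exact sum_congr rfl fun yB _ => by ring
  rw [hC, ← sum_mul, sum_signOf_Fw]
  ring

/-- ★ EXACTNESS + LABEL: `Φ_L(cinst w t) = -(-1)^{q_w(0)_{b₀}}` (modulus exactly `1`). -/
theorem cvalue_cinst (w : Fin m → Bool) (t : ℕ) : (cinst w t).cvalue = - signOf (qv w zeroVec b₀) := by
  show (Real.sqrt (2 ^ (3 * ((kk m + kk m) + (t + t)))))⁻¹ *
    ∑ x : Fin ((kk m + kk m) + (t + t)) → Bool, ∑ y : Fin ((kk m + kk m) + (t + t)) → Bool,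
        signOf ((dsum (Fw w) (ipT t)).eval x) * twist x (mv (blockDiag (zM (kk m + kk m)) dM) y) *
          signOf ((dsum (oneT (kk m + kk m)) (ipT t)).eval y) = _
  rw [csum_cinst, sqrt_two_pow_three_mul_add]
  have h3 : Real.sqrt ((2 : ℝ) ^ (3 * (kk m + kk m))) = 2 ^ kk m * 2 ^ (kk m + kk m) := by
    rw [show 3 * (kk m + kk m) = 3 * kk m + 3 * kk m by ring, SgnForrMem.sqrt_two_pow_add_self, ← pow_add,
      show kk m + (kk m + kk m) = 3 * kk m by ring]
  rw [h3]
  have h4 : Real.sqrt ((2 : ℝ) ^ (3 * (t + t))) ≠ 0 := by positivity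
  have h5 : (2 : ℝ) ^ kk m ≠ 0 := by positivity
  have h6 : (2 : ℝ) ^ (kk m + kk m) ≠ 0 := by positivity
  field_simp

/-- ★ THE KERNEL of the planted coupling has `2^{6m+6}` elements (co-rank `6m+6`). -/
theorem kerCard_cinst (w : Fin m → Bool) (t : ℕ) : (cinst w t).kerCard ≤ 2 ^ (kk m + kk m) := by
  have key : ∀ y : Fin ((kk m + kk m) + (t + t)) → Bool, mv (cinst w t).L y = zeroVec →
      ∀ b, y (Fin.natAdd (kk m + kk m) b) = false := by
    intro y hy b
    obtain ⟨⟨yA, yB⟩, rfl⟩ := (Fin.appendEquiv _ _).surjective y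
    have h2 : mv (blockDiag (zM (kk m + kk m)) dM) (Fin.append yA yB) = zeroVec := hy
    rw [mv_blockDiag, mv_zM, mv_dM] at h2
    have h3 := congr_fun h2 (Fin.natAdd (kk m + kk m) b)
    rw [Fin.append_right] at h3
    show Fin.append yA yB (Fin.natAdd (kk m + kk m) b) = false
    rw [Fin.append_right]; exact h3
  calc (cinst w t).kerCard
      ≤ Fintype.card (Fin (kk m + kk m) → Bool) := Fintype.card_le_of_injective
          (fun y a => y.1 (Fin.castAdd (t + t) a)) (by
            rintro ⟨y, hy⟩ ⟨y', hy'⟩ h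
            apply Subtype.ext
            funext i
            refine Fin.addCases (fun a => ?_) (fun b => ?_) i
            · exact congr_fun h a
            · show y (Fin.natAdd _ b) = y' (Fin.natAdd _ b)
              rw [key y hy b, key y' hy' b])
    _ = 2 ^ (kk m + kk m) := by simp

/-- CouplingDialThreshold helper `isLit_dsum_Fw_cube` (decomp-qadv land package; see the module docstring). -/
theorem isLit_dsum_Fw_cube (t : ℕ) (i j l : Fin ((kk m + kk m) + (t + t))) :
    IsLit fun w : Fin m → Bool => (dsum (Fw w) (ipT t)).cube i j l :=
  isLit_cube3 (c₁ := fun w => (Fw w).cube) isLit_Fw_cube (ipT t).cube _ _ _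

/-- ★ `w ↦ code(cinst w t)` IS A LITERAL PROJECTION. -/
theorem isProj_encode_cinst (t : ℕ) : IsProj fun w : Fin m → Bool => (cinst w t).encode := by
  show IsProj fun w : Fin m → Bool => boolPair (CTriple.matBits (blockDiag (zM (kk m + kk m)) (dM : Fin (t + t) → Fin (t + t) → Bool)))
    (boolPair (encodeNat ((kk m + kk m) + (t + t))) (boolPair (dsum (Fw w) (ipT t)).encode (dsum (oneT (kk m + kk m)) (ipT t)).encode))
  exact (IsProj.const _).boolPair ((IsProj.const _).boolPair
    ((isProj_encode_form (fun w => dsum (Fw w) (ipT t)) false (fun _ => rfl) (isLit_dsum_Fw_cube t)).boolPair (IsProj.const _)))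

/-- the length polynomial of a coupled code in the arity. -/
def tPoly : Polynomial ℕ := 12 * Polynomial.X ^ 3 + 14 * Polynomial.X ^ 2 + 8 * Polynomial.X + 18

/-- CouplingDialThreshold helper `length_encode_le_tPoly` (decomp-qadv land package; see the module docstring). -/
theorem length_encode_le_tPoly (I : CTriple) : I.encode.length ≤ tPoly.eval I.n := by
  have h := length_encode_pair_le I.pair
  rw [CTriple.encode, length_boolPair, length_matBits]
  simp only [tPoly, Polynomial.eval_add, Polynomial.eval_mul, Polynomial.eval_pow, Polynomial.eval_X, Polynomial.eval_ofNat]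
  have : I.pair.n = I.n := rfl
  rw [this, lenB] at h
  nlinarith

/-- the arity polynomial of the planted family with padding schedule bounded by `B`. -/
def nPoly (B : Polynomial ℕ) : Polynomial ℕ := 6 * Polynomial.X + 6 + 2 * B

/-- CouplingDialThreshold helper `cinst_n_le` (decomp-qadv land package; see the module docstring). -/
theorem cinst_n_le (w : Fin m → Bool) {t : ℕ} {B : Polynomial ℕ} (ht : t ≤ B.eval m) : (cinst w t).n ≤ (nPoly B).eval m := by
  show (kk m + kk m) + (t + t) ≤ _
  simp only [nPoly, kk, Polynomial.eval_add, Polynomial.eval_mul, Polynomial.eval_X, Polynomial.eval_ofNat]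
  omega

/-- CouplingDialThreshold helper `length_encode_cinst_le` (decomp-qadv land package; see the module docstring). -/
theorem length_encode_cinst_le (w : Fin m → Bool) {t : ℕ} {B : Polynomial ℕ} (ht : t ≤ B.eval m) :
    (cinst w t).encode.length ≤ (tPoly.comp (nPoly B)).eval m := by
  rw [Polynomial.eval_comp]
  exact (length_encode_le_tPoly _).trans (natPoly_eval_mono tPoly (cinst_n_le w ht))

/-- CouplingDialThreshold helper `even_cinst_n` (decomp-qadv land package; see the module docstring). -/
theorem even_cinst_n (w : Fin m → Bool) (t : ℕ) : Even (cinst w t).n := ⟨kk m + t, by show (kk m + kk m) + (t + t) = _; ring⟩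

/-- CouplingDialThreshold helper `cinst_mem_yes` (decomp-qadv land package; see the module docstring). -/
theorem cinst_mem_yes {d : ℕ → ℕ} (w : Fin m → Bool) {t : ℕ} (hd : kk m + kk m ≤ d ((kk m + kk m) + (t + t)))
    (h3 : GateFn.numOnes w % 3 = 0) : (cinst w t).encode ∈ (CoupledSlice d).yes := by
  refine ⟨cinst w t, ⟨even_cinst_n w t, (kerCard_cinst w t).trans (Nat.pow_le_pow_right Nat.two_pos hd), ?_⟩, rfl⟩
  rw [cvalue_cinst, qv_zeroVec_b₀, decide_eq_true h3]; norm_num [signOf]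

/-- CouplingDialThreshold helper `cinst_mem_no` (decomp-qadv land package; see the module docstring). -/
theorem cinst_mem_no {d : ℕ → ℕ} (w : Fin m → Bool) {t : ℕ} (hd : kk m + kk m ≤ d ((kk m + kk m) + (t + t)))
    (h3 : ¬ GateFn.numOnes w % 3 = 0) : (cinst w t).encode ∈ (CoupledSlice d).no := by
  refine ⟨cinst w t, ⟨even_cinst_n w t, (kerCard_cinst w t).trans (Nat.pow_le_pow_right Nat.two_pos hd), ?_⟩, rfl⟩
  rw [cvalue_cinst, qv_zeroVec_b₀, decide_eq_false h3]; norm_num [signOf]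

/-- ★★★ THE THRESHOLD LAW (schedule form): if a polynomially bounded padding schedule `t(m)` keeps the planted co-rank `6m+6` within the
budget, `6m+6 ≤ d((6m+6) + 2t(m))`, then the rung `U_d` HOLDS.  [PROVED; the planted label is `MOD₃`, Smolensky closes.] -/
theorem couplingRung_of_schedule (d : ℕ → ℕ) (t : ℕ → ℕ) (B : Polynomial ℕ) (ht : ∀ m, t m ≤ B.eval m)
    (hd : ∀ m, kk m + kk m ≤ d ((kk m + kk m) + (t m + t m))) : CouplingRung d :=
  not_promiseLift_AC0Mod_of_proj Nat.prime_two Nat.prime_three (by decide) _ (fun m w => (cinst w (t m)).encode)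
    (fun m => isProj_encode_cinst (t m)) (tPoly.comp (nPoly B)) (fun m w => length_encode_cinst_le w (ht m))
    (fun m w h => cinst_mem_yes w (hd m) h) (fun m w h => cinst_mem_no w (hd m) h)

/-- ★★ RUNG `U_{n}` (no constraint on the coupling) HOLDS — it contains the solo problem, but is proved here unconditionally. -/
theorem couplingRung_id : CouplingRung id :=
  couplingRung_of_schedule id (fun _ => 0) 0 (fun _ => Nat.zero_le _) fun m => by simp

/-- ★★ RUNG `U_{n/2}` HOLDS (padding `t = 3m+3`: arity `12m+12`, co-rank `6m+6`). -/
theorem couplingRung_half : CouplingRung (fun n => n / 2) :=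
  couplingRung_of_schedule _ kk (3 * Polynomial.X + 3) (fun m => by simp [kk]; omega) fun m => by omega

/-- ★★★ RUNG `U_{√n}` HOLDS (padding `t = 2(3m+3)²`: arity `n = (6m+6) + (6m+6)²`, co-rank `6m+6 ≤ √n`).  Likewise every `U_{n^ε}`
(padding `t ≈ (6m+6)^{1/ε}`): THE OPEN REGION OF THE DIAL IS `d(n) = n^{o(1)}`. -/
theorem couplingRung_sqrt : CouplingRung Nat.sqrt :=
  couplingRung_of_schedule _ (fun m => 2 * kk m ^ 2) (2 * (3 * Polynomial.X + 3) ^ 2)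
    (fun m => by simp [kk]; ring_nf; omega) fun m => by
      rw [Nat.le_sqrt]
      nlinarith [Nat.zero_le (kk m)]

end Planting

/-! ## §8 The pieces, the residual, and `closes` BY NAME -/

/-- ★ OPEN RUNG `U_c` (constant co-rank budget `c`). -/
def ConstCouplingRung (c : ℕ) : Prop := CouplingRung fun _ => c

/-- ★ OPEN RUNG `U_{log}` (logarithmic co-rank budget). -/
def LogCouplingRung : Prop := CouplingRung fun n => Nat.log 2 n

/-- CouplingDialThreshold helper `constCouplingRung_of_hidden` (decomp-qadv land package; see the module docstring). -/
theorem constCouplingRung_of_hidden (c : ℕ) : HiddenCouplingRung → ConstCouplingRung c := couplingRung_of_hidden _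

/-- CouplingDialThreshold helper `logCouplingRung_of_hidden` (decomp-qadv land package; see the module docstring). -/
theorem logCouplingRung_of_hidden : HiddenCouplingRung → LogCouplingRung := couplingRung_of_hidden _

/-- CouplingDialThreshold helper `constCouplingRung_mono` (decomp-qadv land package; see the module docstring). -/
theorem constCouplingRung_mono {c c' : ℕ} (h : c ≤ c') : ConstCouplingRung c → ConstCouplingRung c' := couplingRung_mono fun _ => h

/-- ★ THE SPLIT BENEATH THE EQUIV, edge 2: `W ∧ R ⟹ T`. -/
theorem rungANonuniform_of_pieces (w : HiddenCouplingRung) (ℓ : CouplingLift) : RungANonuniform := ℓ w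

/-- ★ `T ⟹ W ∧ R` (both pieces are NECESSARY; `R` is implied by `T` trivially). -/
theorem pieces_of_rungANonuniform (h : RungANonuniform) : HiddenCouplingRung ∧ CouplingLift :=
  ⟨hidden_of_rungANonuniform h, fun _ => h⟩

/-- ★ NODE EQUATION: `T ⟺ W ∧ R`. -/
theorem rungANonuniform_iff_pieces : RungANonuniform ↔ HiddenCouplingRung ∧ CouplingLift :=
  ⟨pieces_of_rungANonuniform, fun h => rungANonuniform_of_pieces h.1 h.2⟩

/-- ★★★ `closes` BY NAME: the node's pieces, with the inherited AnfPresentation items, decide the summit.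
`W` = `HiddenCouplingRung` [WEAKER, OPEN, IDEA-NEEDED], `R` = `CouplingLift` [residual ≡ T mod W, UNDECIDED]; the other binders are the
AnfPresentation route's own items (14043 NearExactIsExact, SignedExactSliceIsLift ✓, 27984 LiftA, AnfEquiv ✓). -/
theorem closes (h₁ : NearExactIsExact) (h₂ : SignedExactSliceIsLift) (w : HiddenCouplingRung) (ℓ : CouplingLift) (p₂ : LiftA)
    (hE : AnfEquiv) : QuantumAdvantage :=
  Summit.QuantumAdvantage.QuantumAdvantage.Theses.AnfPresentation.closes h₁ h₂
    (rungA_of_rungANonuniform (rungANonuniform_of_pieces w ℓ)) p₂ hE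

/-- ★ SUMMARY OF THE DIAL (kernel-checked edges): `T ⟺ T′`, `T ⟹ U_0 = W ⟹ U_c ⟹ U_{c'}` (`c ≤ c'`), `W ⟹ U_log`, `W ⟹ U_d` (all `d`);
THEOREMS `U_{n}`, `U_{n/2}`, `U_{√n}`; OPEN `U_0, U_c, U_log`; `T ⟺ W ∧ (W → T)`. -/
theorem dial_summary :
    (RungANonuniform ↔ IdCouplingRung) ∧ (RungANonuniform → HiddenCouplingRung) ∧ (IdCouplingRung → HiddenCouplingRung) ∧
    (∀ d, HiddenCouplingRung → CouplingRung d) ∧ CouplingRung id ∧ CouplingRung (fun n => n / 2) ∧ CouplingRung Nat.sqrt ∧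
    (RungANonuniform ↔ HiddenCouplingRung ∧ CouplingLift) :=
  ⟨rungANonuniform_iff_idCouplingRung, hidden_of_rungANonuniform, hidden_of_idCouplingRung, couplingRung_of_hidden,
    couplingRung_id, couplingRung_half, couplingRung_sqrt, rungANonuniform_iff_pieces⟩

end Summit.QuantumAdvantage.QuantumAdvantage.Theorems.CouplingDial

end
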